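import Mathlib
import Summits.NavierStokesRegularity.NavierStokesRegularity.Theorems.EulerZoomLiouvillePowerGaugeEulerLiouvilleFluxWindow
import Literature.Analysis.FluidPDE.SpaceTimeRescaling
import Literature.Analysis.FluidPDE.SelfSimilarCollapseAnsatz
import HarnessLib

/-!
# OFF-RATE self-similar members, past form — the far-past slice: `A`-growth of the profile at ANY rate
# (crux `EulerZoomLiouville.PowerGaugeEulerLiouville` = stmt-NavierStokesRegularity-19832; tools for `…SelfSimilarOffRatePast`)

Route `EulerZoomLiouville` (NavierStokesRegularity); width seat ns-ezl-w4 g2.  One lemma: the `A`-gauge of a member that is exactly self-similar about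
`(T, x₀)` on a past sub-slab `τ < T₁` AT AN ARBITRARY RATE `g ≥ 0`, read in profile variables at large scales —
`OffRate.profile_energy_growth_of_gaugeA_past_rate`: `∫_{B_L}‖W‖² ≤ C L^{1−2ρ}` for `L ≥ 2 − T₁` (a copy of the interim LEAD's
`Shifted.profile_energy_growth_of_gaugeA_past`, whose rate was pinned to `1/(2+ρ)`; the rate only enters the constant).

WHAT THIS IS NOT: not NS, not E — a helper lemma `--supports` stmt-19832. [folklore]
-/

noncomputable section

-- flat `Theorems/<Route><Decl>…` files of one crux share the namespace of the crux (tree convention: `Summit.<S>.<S>.…`)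
set_option linter.dupNamespace false

open MeasureTheory Set Filter Topology Metric Function TopologicalSpace
open scoped ENNReal NNReal

namespace Summit.NavierStokesRegularity.NavierStokesRegularity.Theorems.PowerGaugeEulerLiouville

open Literature.Analysis Literature.Analysis.FunctionSpaces Literature.Analysis.FluidPDE

namespace OffRate

variable {ρ g T T₁ : ℝ}
  {u : ℝ → EuclideanSpace ℝ (Fin 3) → EuclideanSpace ℝ (Fin 3)} {c : ℝ≥0}
  {W : EuclideanSpace ℝ (Fin 3) → EuclideanSpace ℝ (Fin 3)}

/-! ### The far-past slice: `A`-growth of the profile at any rate -/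

/-- **THE `A`-GAUGE OF A PAST-EXACT MEMBER OF ANY RATE IN PROFILE VARIABLES (large scales).**  If `u(τ, x) = (T−τ)^{g−1} W((T−τ)^{−g}(x − x₀))` for
`τ < T₁` (`g ≥ 0`, `0 ≤ ρ ≤ ½`, `T₁ ≤ 0`, `T₁ ≤ T`) and `a^{2ρ} A(a; 0) ≤ c` for all `a > 0`, then for some `C < ∞`: `∫_{B_L} ‖W‖² ≤ C L^{1−2ρ}` for
every `L ≥ 2 − T₁` (the gauge on the far-past slice `τ = T₁ − 1` at radius `a = L(T−T₁+1)^g + ‖x₀‖` and the space change of variables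
`y ↦ x₀ + (T−T₁+1)^g y`).  A copy of `Shifted.profile_energy_growth_of_gaugeA_past` with a free rate. [folklore] -/
theorem profile_energy_growth_of_gaugeA_past_rate (hρ : 0 ≤ ρ) (hρh : ρ ≤ 1 / 2) (hg0 : 0 ≤ g) (hT₁ : T₁ ≤ 0) (hTT₁ : T₁ ≤ T)
    (x₀ : EuclideanSpace ℝ (Fin 3))
    (hu : ∀ τ : ℝ, τ < T₁ → u τ = fun x => selfSimilarCollapse g T W τ (x - x₀))
    (hA : ∀ a : ℝ, 0 < a → ENNReal.ofReal (a ^ (2 * ρ)) *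
      cknA a (0 : ℝ × EuclideanSpace ℝ (Fin 3)) u ≤ (c : ℝ≥0∞)) :
    ∃ C : ℝ≥0∞, C ≠ ⊤ ∧ ∀ L : ℝ, 2 - T₁ ≤ L →
      ∫⁻ y in ball (0 : EuclideanSpace ℝ (Fin 3)) L, ‖W y‖ₑ ^ 2 ≤ C * ENNReal.ofReal (L ^ (1 - 2 * ρ)) := by
  -- adapted from `Shifted.profile_energy_growth_of_gaugeA_past` (…SelfSimilarPastExtension), rate `1/(2+ρ) ↦ g`
  have _h := hρ
  -- the far-past slice `τ₁ = T₁ − 1` and `s = T − τ₁ ≥ 1`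
  set τ₁ : ℝ := T₁ - 1 with hτ₁
  set s : ℝ := T - T₁ + 1 with hs
  have hs0 : 0 < s := by rw [hs]; linarith
  have hsτ : T - τ₁ = s := by rw [hτ₁, hs]; ring
  set σ : ℝ := s ^ g with hσ
  have hσ0 : 0 < σ := Real.rpow_pos_of_pos hs0 _
  have h12ρ : 0 ≤ 1 - 2 * ρ := by linarith
  set k : ℝ := s ^ (2 - 2 * g) * (σ ^ 3)⁻¹ * (σ + ‖x₀‖) ^ (1 - 2 * ρ) with hk
  refine ⟨ENNReal.ofReal k * (c : ℝ≥0∞), ENNReal.mul_ne_top ENNReal.ofReal_ne_top ENNReal.coe_ne_top, fun L hL => ?_⟩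
  have hL2 : 2 ≤ L := by linarith
  have hL0 : 0 < L := by linarith
  -- the radius `a`
  set a : ℝ := L * σ + ‖x₀‖ with ha
  have hσ1 : 1 ≤ σ := by
    rw [hσ]; exact Real.one_le_rpow (by rw [hs]; linarith) hg0
  have haL : L ≤ a := by
    have : L * 1 ≤ L * σ := mul_le_mul_of_nonneg_left hσ1 hL0.le
    have := norm_nonneg x₀
    rw [ha]; linarith
  have ha0 : 0 < a := by linarith
  have ha2 : 1 - T₁ < a ^ 2 := by nlinarith
  have hτ : τ₁ ∈ Ioo ((0 : ℝ × EuclideanSpace ℝ (Fin 3)).1 - a ^ 2) (0 : ℝ × EuclideanSpace ℝ (Fin 3)).1 := by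
    simp only [Prod.fst_zero, zero_sub, mem_Ioo]
    constructor <;> [rw [hτ₁]; rw [hτ₁]] <;> linarith
  have hslice : (ENNReal.ofReal a)⁻¹ * ∫⁻ x in ball (0 : EuclideanSpace ℝ (Fin 3)) a, ‖u τ₁ x‖ₑ ^ 2 ≤
      cknA a (0 : ℝ × EuclideanSpace ℝ (Fin 3)) u := by
    unfold cknA
    exact le_iSup₂ (f := fun t (_ : t ∈ Ioo ((0 : ℝ × EuclideanSpace ℝ (Fin 3)).1 - a ^ 2)
        (0 : ℝ × EuclideanSpace ℝ (Fin 3)).1) =>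
        (ENNReal.ofReal a)⁻¹ * ∫⁻ x in ball (0 : ℝ × EuclideanSpace ℝ (Fin 3)).2 a, ‖u t x‖ₑ ^ 2) τ₁ hτ
  set I : ℝ≥0∞ := ∫⁻ x in ball (0 : EuclideanSpace ℝ (Fin 3)) a, ‖u τ₁ x‖ₑ ^ 2 with hI
  have hgauge : ENNReal.ofReal (a ^ (2 * ρ)) * ((ENNReal.ofReal a)⁻¹ * I) ≤ (c : ℝ≥0∞) :=
    calc ENNReal.ofReal (a ^ (2 * ρ)) * ((ENNReal.ofReal a)⁻¹ * I)
        ≤ ENNReal.ofReal (a ^ (2 * ρ)) * cknA a (0 : ℝ × EuclideanSpace ℝ (Fin 3)) u := by gcongr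
      _ ≤ (c : ℝ≥0∞) := hA a ha0
  have hKa : ENNReal.ofReal (a ^ (2 * ρ)) * (ENNReal.ofReal a)⁻¹ = ENNReal.ofReal (a ^ (2 * ρ - 1)) := by
    rw [← ENNReal.ofReal_inv_of_pos ha0, ← ENNReal.ofReal_mul (by positivity), Real.rpow_sub_one ha0.ne',
      div_eq_mul_inv]
  have hIle : I ≤ ENNReal.ofReal (a ^ (1 - 2 * ρ)) * (c : ℝ≥0∞) := by
    have hunit : ENNReal.ofReal (a ^ (1 - 2 * ρ)) * ENNReal.ofReal (a ^ (2 * ρ - 1)) = 1 := by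
      rw [← ENNReal.ofReal_mul (by positivity), ← Real.rpow_add ha0, show (1 - 2 * ρ) + (2 * ρ - 1) = 0 by ring,
        Real.rpow_zero, ENNReal.ofReal_one]
    calc I = ENNReal.ofReal (a ^ (1 - 2 * ρ)) * (ENNReal.ofReal (a ^ (2 * ρ - 1)) * I) := by
          rw [← mul_assoc, hunit, one_mul]
      _ = ENNReal.ofReal (a ^ (1 - 2 * ρ)) * (ENNReal.ofReal (a ^ (2 * ρ)) * ((ENNReal.ofReal a)⁻¹ * I)) := by
          rw [← mul_assoc (ENNReal.ofReal (a ^ (2 * ρ))), hKa]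
      _ ≤ ENNReal.ofReal (a ^ (1 - 2 * ρ)) * (c : ℝ≥0∞) := by gcongr
  -- ### change of variables `x = x₀ + σ y` on the far-past slice
  have hval : ∀ y : EuclideanSpace ℝ (Fin 3),
      ‖u τ₁ (x₀ + σ • y)‖ₑ ^ 2 = ENNReal.ofReal (s ^ (2 * (g - 1))) * ‖W y‖ₑ ^ 2 := by
    intro y
    rw [hu τ₁ (by rw [hτ₁]; linarith)]
    simp only [selfSimilarCollapse_apply, add_sub_cancel_left, smul_smul]
    rw [hsτ, hσ, ← Real.rpow_add hs0, show -g + g = 0 by ring, Real.rpow_zero,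
      one_smul, enorm_smul, mul_pow, Real.enorm_eq_ofReal (Real.rpow_nonneg hs0.le _),
      ← ENNReal.ofReal_pow (Real.rpow_nonneg hs0.le _), ← Real.rpow_natCast (s ^ (g - 1)) 2,
      ← Real.rpow_mul hs0.le, show (g - 1) * ((2 : ℕ) : ℝ) = 2 * (g - 1) by push_cast; ring]
  have hpre : ball (0 : EuclideanSpace ℝ (Fin 3)) L ⊆
      (fun y : EuclideanSpace ℝ (Fin 3) => x₀ + σ • y) ⁻¹' ball (0 : EuclideanSpace ℝ (Fin 3)) a := by
    intro y hy
    rw [mem_ball_zero_iff] at hy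
    rw [mem_preimage, mem_ball_zero_iff]
    calc ‖x₀ + σ • y‖ ≤ ‖x₀‖ + ‖σ • y‖ := norm_add_le _ _
      _ = ‖x₀‖ + σ * ‖y‖ := by rw [norm_smul, Real.norm_of_nonneg hσ0.le]
      _ < ‖x₀‖ + σ * L := by gcongr
      _ = a := by rw [ha]; ring
  have hcov := setLIntegral_preimage_comp_space_affine hσ0 x₀
    (fun x : EuclideanSpace ℝ (Fin 3) => ‖u τ₁ x‖ₑ ^ 2) (ball (0 : EuclideanSpace ℝ (Fin 3)) a)
  rw [finrank_euclideanSpace_fin] at hcov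
  have hmain : ENNReal.ofReal (s ^ (2 * (g - 1))) * ∫⁻ y in ball (0 : EuclideanSpace ℝ (Fin 3)) L, ‖W y‖ₑ ^ 2 ≤
      ENNReal.ofReal (σ ^ 3)⁻¹ * I := by
    rw [← hcov, ← lintegral_const_mul' _ _ ENNReal.ofReal_ne_top]
    calc ∫⁻ y in ball (0 : EuclideanSpace ℝ (Fin 3)) L, ENNReal.ofReal (s ^ (2 * (g - 1))) * ‖W y‖ₑ ^ 2
        = ∫⁻ y in ball (0 : EuclideanSpace ℝ (Fin 3)) L, ‖u τ₁ (x₀ + σ • y)‖ₑ ^ 2 :=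
          lintegral_congr fun y => (hval y).symm
      _ ≤ ∫⁻ y in (fun y : EuclideanSpace ℝ (Fin 3) => x₀ + σ • y) ⁻¹' ball (0 : EuclideanSpace ℝ (Fin 3)) a,
            ‖u τ₁ (x₀ + σ • y)‖ₑ ^ 2 := lintegral_mono_set hpre
  -- ### assemble
  have haL' : a ^ (1 - 2 * ρ) ≤ (σ + ‖x₀‖) ^ (1 - 2 * ρ) * L ^ (1 - 2 * ρ) := by
    rw [← Real.mul_rpow (by positivity) hL0.le]
    refine Real.rpow_le_rpow ha0.le ?_ h12ρ
    have : ‖x₀‖ ≤ ‖x₀‖ * L := le_mul_of_one_le_right (norm_nonneg _) (by linarith)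
    rw [ha]; nlinarith
  have hunit2 : ENNReal.ofReal (s ^ (2 - 2 * g)) * ENNReal.ofReal (s ^ (2 * (g - 1))) = 1 := by
    rw [← ENNReal.ofReal_mul (Real.rpow_nonneg hs0.le _), ← Real.rpow_add hs0,
      show (2 - 2 * g) + 2 * (g - 1) = 0 by ring, Real.rpow_zero, ENNReal.ofReal_one]
  calc ∫⁻ y in ball (0 : EuclideanSpace ℝ (Fin 3)) L, ‖W y‖ₑ ^ 2
      = ENNReal.ofReal (s ^ (2 - 2 * g)) *
          (ENNReal.ofReal (s ^ (2 * (g - 1))) * ∫⁻ y in ball (0 : EuclideanSpace ℝ (Fin 3)) L, ‖W y‖ₑ ^ 2) := by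
        rw [← mul_assoc, hunit2, one_mul]
    _ ≤ ENNReal.ofReal (s ^ (2 - 2 * g)) * (ENNReal.ofReal (σ ^ 3)⁻¹ * I) := by gcongr
    _ ≤ ENNReal.ofReal (s ^ (2 - 2 * g)) * (ENNReal.ofReal (σ ^ 3)⁻¹ *
          (ENNReal.ofReal (a ^ (1 - 2 * ρ)) * (c : ℝ≥0∞))) := by gcongr
    _ ≤ ENNReal.ofReal (s ^ (2 - 2 * g)) * (ENNReal.ofReal (σ ^ 3)⁻¹ *
          (ENNReal.ofReal ((σ + ‖x₀‖) ^ (1 - 2 * ρ) * L ^ (1 - 2 * ρ)) * (c : ℝ≥0∞))) := by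
        gcongr
    _ = ENNReal.ofReal k * (c : ℝ≥0∞) * ENNReal.ofReal (L ^ (1 - 2 * ρ)) := by
        rw [hk, ENNReal.ofReal_mul (by positivity), ENNReal.ofReal_mul (by positivity),
          ENNReal.ofReal_mul (by positivity)]
        ring

end OffRate

end Summit.NavierStokesRegularity.NavierStokesRegularity.Theorems.PowerGaugeEulerLiouville

end
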